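import Literature.NumberTheory.GaloisRepresentations.ContinuousRep
import HarnessLib

/-!
# A rank-one factor of `det (X - ρ g)` is trivial wherever `ρ g = 1`
(crux stmt-Langlands-14329 `IrreducibilityBySelfDuality.IrreducibleOffSector`, line `Sketch`;
`--supports` file, lead c8 CONSTITUENT package)

If a framed representation `ρ : G →ₜ* GL_n(k)` satisfies `ρ g = 1` and the characteristic
polynomial of a rank-one framed representation (continuous character) `χ : G →ₜ* GL_1(k)` at `g`
divides that of `ρ` at `g`, then `χ g = 1`.  Indeed `det (X - ρ g) = det (X - 1) = (X - 1)^n`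
(Mathlib `Matrix.charpoly_one`), `det (X - χ g) = X - C c` with `c` the unique entry of the
`1 × 1` matrix `χ g`, and a monic linear factor `X - C c` of `(X - 1)^n` has `c` a root of
`(X - 1)^n` (`Polynomial.dvd_iff_isRoot`), so `(c - 1)^n = 0` and `c = 1` in the field `k`.
This is the "unramified wherever `ρ` is" input needed to feed the rank-one constituents of a
reducible compatible system into Böckle–Hui.  Reference: Bourbaki, *Algèbre* VIII §20 n°6
(folklore linear algebra).
-/

set_option linter.dupNamespace false

open Polynomial
open Literature.NumberTheory.GaloisRepresentations

namespace Summit.Langlands.Langlands.Theorems.IrreducibleOffSector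

/-- **A rank-one factor of `det (X - ρ g)` is trivial at `g` whenever `ρ g = 1`.**  If `ρ g = 1`
and `det (X - χ g) ∣ det (X - ρ g)` for a rank-one framed representation `χ`, then `χ g = 1`:
`det (X - ρ g) = (X - 1)^n`, `det (X - χ g) = X - C c` with `c = (χ g)₀₀`, so `c` is a root of
`(X - 1)^n`, i.e. `(c - 1)^n = 0`, whence `c = 1`. [folklore] -/
theorem eq_one_of_charpoly_dvd {G : Type*} [Group G] [TopologicalSpace G] {k : Type*} [Field k]
    [TopologicalSpace k] {n : ℕ} (ρ : FramedRep G k n) (χ : FramedRep G k 1) {g : G}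
    (hg : ρ g = 1) (h : χ.charpoly g ∣ ρ.charpoly g) : χ g = 1 := by
  have hρ : ρ.charpoly g = (X - C 1) ^ n := by
    rw [FramedRep.charpoly, hg, Units.val_one, Matrix.charpoly_one, Fintype.card_fin, C_1]
  have hχ : χ.charpoly g = X - C (((χ g : GL (Fin 1) k) : Matrix (Fin 1) (Fin 1) k) 0 0) := by
    rw [FramedRep.charpoly, Matrix.charpoly, Matrix.det_fin_one, Matrix.charmatrix_apply_eq]
  rw [hρ, hχ, dvd_iff_isRoot, IsRoot.def, eval_pow, eval_sub, eval_X, eval_C] at h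
  have h1 : ((χ g : GL (Fin 1) k) : Matrix (Fin 1) (Fin 1) k) 0 0 = 1 :=
    sub_eq_zero.mp (eq_zero_of_pow_eq_zero h)
  refine Units.ext (Matrix.ext fun i j => ?_)
  rw [Subsingleton.elim i 0, Subsingleton.elim j 0, Units.val_one, Matrix.one_apply_eq]
  exact h1

end Summit.Langlands.Langlands.Theorems.IrreducibleOffSector
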